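/-
Copyright (c) 2026 the pub-hodgecm-mathlib formalisation cell (harness21).  Prover seat hodgecm-mathlib-LH3-p04 (g3): LH3 «Transf» road,
organ-grade head (SB-TRANSF) = (I₁)+(I₂) of `transfFam` (dealer LH3-plan (g3) board #1 (i) + RULINGS #2 (SB) 2026-09-02T07:16Z), the assembly of the census cut.
-/
import Literature.NumberTheory.Rogawski1990.ArchTransfFamilyJetBounds               -- LH3-p04 (g3): (I₁) bounds of `transfFamReg` on `K ∩ RegG S`; brings `ArchTransfFamilyResolved` (tame points) + ★ p850123 (arrangement gluing)
import Literature.NumberTheory.Rogawski1990.ArchTransfFamilyWeylDischarge           -- ★ p850030 LH4-p01 (g2): `transfFam_eq_zero_of_not_admissible`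
import Literature.Analysis.Calculus.SmoothGluingAcrossHyperplaneRay                 -- ★ p850006 F0P3a-p02 (g19): `extendFrom_congr_of_nhdsWithin_eq`
import HarnessLib

/-!
# (SB-TRANSF) assembled: `transfFam … S` is `C^∞` on Bouaziz's `T_{in-reg} = InRegS S` with (I₁) jet bounds — modulo the κ-pair gluing at the indefinite compact places
# (Bouaziz 1994 §3.2 (I₁)–(I₂) p. 579, Rem. 2 p. 594; Shelstad 1979 §4, Thm. 4.7; Rogawski 1990 §4.3 (4.3.1) p. 43, §8.2 p. 119)

Topic `NumberTheory/Rogawski1990`; namespace `Literature.NumberTheory.Rogawski1990`.  THEOREMS ONLY (no `def`, no instance, no notation, no axiom, no named fact,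
no `sorry`); kernel lane `--supports stmt-HodgeConjecture-24833`.  Cell `pub/hodgecm-mathlib`, crux H413 (`stmt-HodgeConjecture-24833`), F0∕P3c line LH3 (closer stub
`stub_N9`, DIRECT ROAD «Transf», organ O-L2 `stub_N9transf`); organ-grade head **(SB-TRANSF)** `ArchBzSmoothBounded (transfFam L α μ F)` (dealer LH3-plan (g3) RULINGS #2
(SB) 2026-09-02T07:16Z: «(c1) `contDiffOn_transfFam_inRegS` + (c2) the (I₁) bound on `K ∩ InRegS S` ⇒ `archBzSmoothBounded_transfFam_of_hc`»), ASSEMBLED from LH3-p04 (g3)'s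
pieces ★ p850123 (corners), ★ p850171 (tame points), `ArchTransfFamilyJetBounds` ((I₁) on `K ∩ RegG`) and ONE INPUT BY STATEMENT: the local smoothness of `transfFam … S`
at the SEMIREGULAR points of the `H`-regular `G`-walls at the INDEFINITE compact places (the κ-pair cancellation `'F + 'F∘s` across a NONCOMPACT `G′`-wall — F0P3a-p09 (g5)'s
(GLUE-X-dress) FILE B head `contDiffOn_transfFam_nhds_of_hcSemireg` + its `2πk` rider), carried here as the hypothesis `hwall` (ED. 2 discharges it by import when ★).

THE ASSEMBLY (`contDiffOn_transfFam_inRegS_of_wall`).  Fix `p ∈ InRegS S`.  The walls of `transfFam … S` through `p` are: the `G`-walls `c_{w1} − c_{wt} = p_{w1} − p_{wt}`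
(`w ∉ S`, `t ∈ {0, 2}`, `e^{ip_{w1}} = e^{ip_{wt}}`) and the real walls `c_{w0} = 0` (`w ∈ S`, `p_{w0} = 0`) — indexed by `T ⊆ W × Fin 3`, at PAIRWISE DISTINCT places (two
`G`-walls at one compact place would force `e^{ip_{w0}} = e^{ip_{w2}}`, excluded by `InRegS`), hence TRANSVERSAL (the sum of the coordinate vectors `e_{w_j,·}` of the other
walls lies in the wall `i` and leaves every wall `j ≠ i`).  On a small open `U ∋ p` (inside `InRegS S`, same `2π`-branch, no other wall) the `T`-regular set is exactly
`U ∩ RegG S`, where `transfFamReg` is `C^∞` (★ p850171) with jets bounded near every point (`ArchTransfFamilyJetBounds`); at a SIMPLE point of a wall of `T` the family is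
`C^∞` nearby — by ★ p850171 `exists_nhds_contDiffOn_transfFam_of_tame` for a real wall or a `G`-wall at a DEFINITE place, by `hwall` at an INDEFINITE place — and
`transfFam … S = extendFrom (RegG S) transfFamReg` on `InRegS S`; so ★ p850123 `contDiffOn_extendFrom_of_arrangement` glues: `transfFam … S` is `C^∞` on `U`.  (c2): the
(I₁) bound on `K ∩ InRegS S` follows from the bound on `K′ ∩ RegG S` for the compact thickening `K′ = cthickening 1 K` by continuity of the jets on `InRegS S` and density of
`RegG S` (★ `dense_regG`).  Inadmissible `S`: `transfFam … S = 0` (★ p850030).  TOP HEAD `archBzSmoothBounded_transfFam_of_hc_of_wall`; (M2) `hcont` of ★ p850030 ∕ the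
L2 assembler ★ p850089 is its `.continuousOn`.

HONEST LABEL: HC_CM is proved only modulo the 7 printed citations (2 remaining: hLiu418 = `stmt-HodgeConjecture-24832`, h413 = `stmt-HodgeConjecture-24833`) until rung 0
closes; this file is the (SB-TRANSF) conjunct of organ O-L2 MODULO the by-statement input `hwall` (F0P3a-p09 (g5)'s FILE B), count-neutral.

## References
* [Bouaziz1994IntegralesOrbitales] A. Bouaziz, *Intégrales orbitales sur les groupes de Lie réductifs*, Ann. Sci. ÉNS 27 (1994), §3.2 (I₁)–(I₂) p. 579, §6.2 p. 591, Rem. 2 p. 594.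
* [Shelstad1979] D. Shelstad, *Characters and inner forms of a quasi-split group over ℝ*, Compositio Math. 39 (1979), §4 pp. 22–23, Thm. 4.7 p. 31.
* [Rogawski1990] J. D. Rogawski, *Automorphic Representations of Unitary Groups in Three Variables*, Ann. of Math. Stud. 123 (1990), §4.3 (4.3.1) p. 43, §8.2 p. 119.
* [Varadarajan1977] V. S. Varadarajan, *Harmonic Analysis on Real Reductive Groups*, LNM 576 (1977), Part I §1.12.
-/

set_option autoImplicit false

noncomputable section

open NumberField NumberField.InfinitePlace Complex Equiv Finset Filter Topology Set Metric
open scoped MatrixGroups ComplexConjugate Classical ContDiff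
open Literature.NumberTheory.Automorphic Literature.NumberTheory.Automorphic.UnitaryGroup Literature.NumberTheory.Automorphic.ArchCartan
open Literature.NumberTheory.GaloisRepresentations Literature.Analysis.Calculus

namespace Literature.NumberTheory.Rogawski1990

/-! ## §1 Coordinate bookkeeping: the wall forms, the `2π`-branch lemma, injectivity from three inequalities -/

section Coordinates

variable {W : Type*} [Fintype W] [DecidableEq W]

omit [Fintype W] [DecidableEq W] in
/-- **The wall forms as continuous linear forms**: `ℓ (w, 1) c = c_{w0}` (real wall), `ℓ (w, t) c = c_{w1} − c_{wt}` (`t ≠ 1`, the `G`-walls at a compact place).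
[cite: Shelstad1979, §4 p. 22] -/
theorem exists_clm_wallForm :
    ∃ ℓ : W × Fin 3 → (W → Fin 3 → ℝ) →L[ℝ] ℝ, ∀ (q : W × Fin 3) (c : W → Fin 3 → ℝ), ℓ q c = if q.2 = 1 then c q.1 0 else c q.1 1 - c q.1 q.2 := by
  refine ⟨fun q => if q.2 = 1 then (ContinuousLinearMap.proj (R := ℝ) (φ := fun _ : Fin 3 => ℝ) 0).comp (ContinuousLinearMap.proj (R := ℝ) (φ := fun _ : W => Fin 3 → ℝ) q.1)
    else (ContinuousLinearMap.proj (R := ℝ) (φ := fun _ : Fin 3 => ℝ) 1).comp (ContinuousLinearMap.proj (R := ℝ) (φ := fun _ : W => Fin 3 → ℝ) q.1) -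
      (ContinuousLinearMap.proj (R := ℝ) (φ := fun _ : Fin 3 => ℝ) q.2).comp (ContinuousLinearMap.proj (R := ℝ) (φ := fun _ : W => Fin 3 → ℝ) q.1), fun q c => ?_⟩
  by_cases h : q.2 = 1
  · simp only [h, if_true]; rfl
  · simp only [h, if_false]; rfl

omit [Fintype W] [DecidableEq W] in
/-- **The `2π`-branch lemma**: if `e^{ia₀} = e^{ib₀}`, `e^{ia} = e^{ib}` and `|a − a₀|, |b − b₀| < π∕2`, then `a − b = a₀ − b₀` (the integer `(a−b−a₀+b₀)∕2π` has modulus `< 1∕2`).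
[cite: Rogawski1990, §8.2 p. 118] -/
theorem sub_eq_sub_of_circleExp_eq {a b a₀ b₀ : ℝ} (h₀ : Circle.exp a₀ = Circle.exp b₀) (h : Circle.exp a = Circle.exp b) (ha : |a - a₀| < Real.pi / 2)
    (hb : |b - b₀| < Real.pi / 2) : a - b = a₀ - b₀ := by
  obtain ⟨m, hm⟩ := Circle.exp_eq_exp.1 h
  obtain ⟨m₀, hm₀⟩ := Circle.exp_eq_exp.1 h₀
  have hk : ((m - m₀ : ℤ) : ℝ) * (2 * Real.pi) = (a - a₀) - (b - b₀) := by push_cast; linarith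
  have habs : |((m - m₀ : ℤ) : ℝ)| * (2 * Real.pi) < Real.pi := by
    have h1 : |(a - a₀) - (b - b₀)| < Real.pi := (abs_sub _ _).trans_lt (by linarith)
    rwa [← hk, abs_mul, abs_of_pos Real.two_pi_pos] at h1
  have hlt : |((m - m₀ : ℤ) : ℝ)| < 1 := by nlinarith [Real.pi_pos, abs_nonneg (((m - m₀ : ℤ) : ℝ))]
  have hz : m - m₀ = 0 := by
    rw [← Int.cast_abs] at hlt
    exact Int.abs_lt_one_iff.1 (by exact_mod_cast hlt)
  have hmm : m = m₀ := by linarith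
  rw [hm, hm₀, hmm]; ring

omit [Fintype W] [DecidableEq W] in
/-- Three pairwise distinct unit eigenvalues ⇒ the slot-to-eigenvalue map is injective. [cite: Shelstad1979, §4 p. 22] -/
theorem injective_circleExp_of_ne {f : Fin 3 → ℝ} (h01 : Circle.exp (f 0) ≠ Circle.exp (f 1)) (h02 : Circle.exp (f 0) ≠ Circle.exp (f 2))
    (h12 : Circle.exp (f 1) ≠ Circle.exp (f 2)) : Function.Injective fun i : Fin 3 => Circle.exp (f i) := by
  intro i j hij
  fin_cases i <;> fin_cases j
  · rfl
  · exact absurd hij h01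
  · exact absurd hij h02
  · exact absurd hij.symm h01
  · rfl
  · exact absurd hij h12
  · exact absurd hij.symm h02
  · exact absurd hij.symm h12
  · rfl

omit [Fintype W] [DecidableEq W] in
/-- Two distinct `G`-walls `e^{if₁} = e^{if_t}`, `e^{if₁} = e^{if_{t′}}` (`t ≠ t′` in `{0, 2}`) at one compact place force the `H`-wall `e^{if₀} = e^{if₂}`.
[cite: Rogawski1990, §8.2 p. 118] -/
theorem circleExp_zero_eq_two_of_two_walls {f : Fin 3 → ℝ} {t t' : Fin 3} (ht1 : t ≠ 1) (ht1' : t' ≠ 1) (htt : t ≠ t')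
    (e : Circle.exp (f 1) = Circle.exp (f t)) (e' : Circle.exp (f 1) = Circle.exp (f t')) : Circle.exp (f 0) = Circle.exp (f 2) := by
  fin_cases t <;> fin_cases t'
  · exact absurd rfl htt
  · exact absurd rfl ht1'
  · exact e.symm.trans e'
  · exact absurd rfl ht1
  · exact absurd rfl ht1
  · exact absurd rfl ht1
  · exact e'.symm.trans e
  · exact absurd rfl ht1'
  · exact absurd rfl htt

omit [DecidableEq W] in
/-- Coordinates of points of a sup-norm ball are close. [cite: Shelstad1979, §4 p. 22] -/
theorem abs_sub_lt_of_mem_ball {p c : W → Fin 3 → ℝ} {r : ℝ} (hr : 0 < r) (hc : c ∈ ball p r) (w : W) (i : Fin 3) : |c w i - p w i| < r := by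
  have h1 : dist c p < r := hc
  have h2 : dist (c w) (p w) < r := (dist_pi_lt_iff hr).1 h1 w
  have h3 : dist (c w i) (p w i) < r := (dist_pi_lt_iff hr).1 h2 i
  rwa [Real.dist_eq] at h3

end Coordinates

/-! ## §2 `transfFam = extendFrom (RegG S) transfFamReg` on `InRegS S`; `transfFamReg` is `C^∞` on `RegG S` -/

section Extend

variable (L : Type) [Field L] [NumberField L] [IsCMField L] (α : Fin 3 → L) (μ : HeckeCharacter L)

/-- **`transfFamReg` is `C^∞` on the `G`-regular set** (it is `transfFam` there, ★ p850171 `contDiffOn_transfFam_regG`). [cite: Rogawski1990, §4.3 (4.3.1) p. 43]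
[cite: Bouaziz1994IntegralesOrbitales, §3.2 (I₁) p. 579] -/
theorem contDiffOn_transfFamReg_regG
    (hμω : ∀ x : ideleGroup ↥(maximalRealSubfield L), μ (AdeleRing.ideleBaseChange (↥(maximalRealSubfield L)) L x) = quadraticHeckeCharCM L x)
    {S : Finset {w : InfinitePlace L // IsComplex w}} (hS : ∀ w ∈ S, w ∈ splitChartPlaces L α)
    {F : Finset {w : InfinitePlace L // IsComplex w} → ({w : InfinitePlace L // IsComplex w} → Fin 3 → ℝ) → ℂ} (hI1 : ContDiffOn ℝ ∞ (F S) (InRegG (slotSign L α) S)) :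
    ContDiffOn ℝ ∞ (transfFamReg L α μ F S) (RegG S) :=
  (contDiffOn_transfFam_regG L α μ hμω hS hI1).congr fun _ hc => (transfFam_of_mem_regG L α μ F S hc).symm

omit [IsCMField L] in
/-- **On `InRegS S`, `transfFam … S` IS the extension of `transfFamReg` from the `G`-regular set** (at a `G`-regular point the extension returns the value, `transfFamReg` being continuous
there). [cite: Bouaziz1994IntegralesOrbitales, §3.1 p. 579] [cite: Rogawski1990, §4.9 Prop. 4.9.1 (a) p. 55] -/
theorem transfFam_eq_extendFrom_of_mem_inRegS [IsCMField L] {S : Finset {w : InfinitePlace L // IsComplex w}}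
    {F : Finset {w : InfinitePlace L // IsComplex w} → ({w : InfinitePlace L // IsComplex w} → Fin 3 → ℝ) → ℂ} (hcont : ContinuousOn (transfFamReg L α μ F S) (RegG S))
    {c : {w : InfinitePlace L // IsComplex w} → Fin 3 → ℝ} (hc : c ∈ InRegS S) :
    transfFam L α μ F S c = extendFrom (RegG S) (transfFamReg L α μ F S) c := by
  by_cases hcR : c ∈ RegG S
  · rw [transfFam_of_mem_regG L α μ F S hcR, extendFrom_extends hcont c hcR]
  · exact transfFam_of_mem_inRegS_of_not_mem_regG L α μ F S hc hcR

end Extend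

/-! ## §3 (c1): `transfFam … S` is `C^∞` on `InRegS S`, the κ-pair gluing at indefinite places taken by statement -/

section Assembly

variable (L : Type) [Field L] [NumberField L] [IsCMField L] (α : Fin 3 → L) (μ : HeckeCharacter L)

/-- **(c1) `transfFam … S` IS `C^∞` ON BOUAZIZ'S `T_{in-reg} = InRegS S`** for an admissible chart `S`, under the `μ`-guard, for `F` with HC's (I₁) (smooth on ★ `InRegG` with bounded
jets), GIVEN (`hwall`) the local smoothness of `transfFam … S` at the semiregular points of the `H`-regular `G`-walls `e^{ic_{w1}} = e^{ic_{wt}}` (`t ∈ {0,2}`) at the INDEFINITE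
compact places `w ∉ S` (the κ-pair cancellation across a noncompact `G′`-wall — F0P3a-p09 (g5)'s FILE B).  Everything else — `RegG S`, the real walls `x_w = 0`, the `G`-walls at
definite places, and ALL CORNERS — is assembled here from ★ p850171 (tame points) and ★ p850123 (transversal arrangement gluing), with the jet bounds of
`ArchTransfFamilyJetBounds`. [cite: Bouaziz1994IntegralesOrbitales, §3.2 (I₁)–(I₂) p. 579; Rem. 2 p. 594] [cite: Shelstad1979, Thm. 4.7 (p. 31)] [cite: Rogawski1990, §8.2 p. 119] -/
theorem contDiffOn_transfFam_inRegS_of_wall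
    (hμω : ∀ x : ideleGroup ↥(maximalRealSubfield L), μ (AdeleRing.ideleBaseChange (↥(maximalRealSubfield L)) L x) = quadraticHeckeCharCM L x)
    {S : Finset {w : InfinitePlace L // IsComplex w}} (hS : ∀ w ∈ S, w ∈ splitChartPlaces L α)
    {F : Finset {w : InfinitePlace L // IsComplex w} → ({w : InfinitePlace L // IsComplex w} → Fin 3 → ℝ) → ℂ}
    (hI1 : ContDiffOn ℝ ∞ (F S) (InRegG (slotSign L α) S))
    (hI1b : ∀ (n : ℕ) (K : Set ({w : InfinitePlace L // IsComplex w} → Fin 3 → ℝ)), IsCompact K →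
      BddAbove ((fun c => ‖iteratedFDeriv ℝ n (F S) c‖) '' (K ∩ InRegG (slotSign L α) S)))
    (hwall : ∀ w : {w : InfinitePlace L // IsComplex w}, w ∉ S → IsIndefiniteAt (slotSign L α) w → ∀ t : Fin 3, t ≠ 1 →
      ∀ q : {w : InfinitePlace L // IsComplex w} → Fin 3 → ℝ, q ∈ InRegS S → Circle.exp (q w 1) = Circle.exp (q w t) →
        (∀ w', w' ∉ S → w' ≠ w → Function.Injective fun l : Fin 3 => Circle.exp (q w' l)) → (∀ w' ∈ S, q w' 0 ≠ 0) →
        ∃ V ∈ 𝓝 q, ContDiffOn ℝ ∞ (transfFam L α μ F S) V) :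
    ContDiffOn ℝ ∞ (transfFam L α μ F S) (InRegS S) := by
  -- abbreviations (`obtain`-naming keeps the big terms opaque)
  obtain ⟨f, hfdef⟩ : ∃ f : ({w : InfinitePlace L // IsComplex w} → Fin 3 → ℝ) → ℂ, f = transfFamReg L α μ F S := ⟨_, rfl⟩
  have hfreg : ContDiffOn ℝ ∞ f (RegG S) := by rw [hfdef]; exact contDiffOn_transfFamReg_regG L α μ hμω hS hI1
  have hext : ∀ c ∈ InRegS S, transfFam L α μ F S c = extendFrom (RegG S) f c :=
    fun c hc => by rw [hfdef]; exact transfFam_eq_extendFrom_of_mem_inRegS L α μ (hfdef ▸ hfreg).continuousOn hc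
  obtain ⟨ℓ, hℓ⟩ := exists_clm_wallForm (W := {w : InfinitePlace L // IsComplex w})
  refine contDiffOn_of_locally_contDiffOn fun p hp => ?_
  -- the walls through `p`
  obtain ⟨T, hTdef⟩ : ∃ T : Finset ({w : InfinitePlace L // IsComplex w} × Fin 3), T = Finset.univ.filter fun q =>
    (q.1 ∈ S ∧ q.2 = 1 ∧ p q.1 0 = 0) ∨ (q.1 ∉ S ∧ q.2 ≠ 1 ∧ Circle.exp (p q.1 1) = Circle.exp (p q.1 q.2)) := ⟨_, rfl⟩
  have hT : ∀ q : {w : InfinitePlace L // IsComplex w} × Fin 3, q ∈ T ↔ (q.1 ∈ S ∧ q.2 = 1 ∧ p q.1 0 = 0) ∨ (q.1 ∉ S ∧ q.2 ≠ 1 ∧ Circle.exp (p q.1 1) = Circle.exp (p q.1 q.2)) := by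
    intro q; rw [hTdef]; simp only [Finset.mem_filter, Finset.mem_univ, true_and]
  -- the levels
  obtain ⟨a, hadef⟩ : ∃ a : {w : InfinitePlace L // IsComplex w} × Fin 3 → ℝ, a = fun q => if q.2 = 1 then 0 else p q.1 1 - p q.1 q.2 := ⟨_, rfl⟩
  -- every wall of `T` passes through `p`
  have hpT : ∀ q ∈ T, ℓ q p = a q := by
    intro q hq
    rw [hℓ]
    rcases (hT q).1 hq with ⟨_, h2, h3⟩ | ⟨_, h2, _⟩
    · simp only [h2, if_true, hadef]; exact h3
    · simp only [h2, if_false, hadef]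
  -- two walls of `T` at the same place coincide
  have hplace : ∀ q ∈ T, ∀ q' ∈ T, q.1 = q'.1 → q = q' := by
    intro q hq q' hq' h
    rcases (hT q).1 hq with ⟨h1, h2, _⟩ | ⟨h1, h2, h3⟩ <;> rcases (hT q').1 hq' with ⟨h1', h2', _⟩ | ⟨h1', h2', h3'⟩
    · exact Prod.ext h (h2.trans h2'.symm)
    · exact absurd (h ▸ h1) h1'
    · exact absurd (h.symm ▸ h1') h1
    · -- two `G`-walls at one compact place would force the `H`-wall
      by_contra hne
      have ht : q.2 ≠ q'.2 := fun h' => hne (Prod.ext h h')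
      have h3'' : Circle.exp (p q.1 1) = Circle.exp (p q.1 q'.2) := by rw [h]; exact h3'
      exact hp q.1 h1 (circleExp_zero_eq_two_of_two_walls h2 h2' ht h3 h3'')
  -- the open neighbourhood `U`
  have hπ : (0 : ℝ) < Real.pi / 2 := by positivity
  obtain ⟨O, hOdef⟩ : ∃ O : Set ({w : InfinitePlace L // IsComplex w} → Fin 3 → ℝ), O = InRegS S ∩ {c | ∀ w ∈ S, p w 0 ≠ 0 → c w 0 ≠ 0} ∩
    {c | ∀ w, w ∉ S → ∀ t : Fin 3, t ≠ 1 → Circle.exp (p w 1) ≠ Circle.exp (p w t) → Circle.exp (c w 1) ≠ Circle.exp (c w t)} := ⟨_, rfl⟩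
  have hO : IsOpen O := by
    rw [hOdef]
    refine ((isOpen_inRegS S).inter ?_).inter ?_
    · have h : {c : {w : InfinitePlace L // IsComplex w} → Fin 3 → ℝ | ∀ w ∈ S, p w 0 ≠ 0 → c w 0 ≠ 0} = ⋂ w ∈ (↑S : Set {w : InfinitePlace L // IsComplex w}), {c | p w 0 ≠ 0 → c w 0 ≠ 0} := by
        ext c; simp only [mem_setOf_eq, mem_iInter, Finset.mem_coe]
      rw [h]
      refine isOpen_biInter_finset fun w _ => ?_
      have h' : {c : {w : InfinitePlace L // IsComplex w} → Fin 3 → ℝ | p w 0 ≠ 0 → c w 0 ≠ 0} = {c | ¬ (p w 0 ≠ 0)} ∪ {c | c w 0 ≠ 0} := by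
        ext c; simp only [mem_setOf_eq, mem_union]; tauto
      rw [h']
      exact isOpen_const.union (isOpen_ne_fun ((continuous_apply 0).comp (continuous_apply w)) continuous_const)
    · have h : {c : {w : InfinitePlace L // IsComplex w} → Fin 3 → ℝ | ∀ w, w ∉ S → ∀ t : Fin 3, t ≠ 1 → Circle.exp (p w 1) ≠ Circle.exp (p w t) → Circle.exp (c w 1) ≠ Circle.exp (c w t)} =
          ⋂ w ∈ ((↑S : Set {w : InfinitePlace L // IsComplex w})ᶜ), ⋂ t ∈ ({t : Fin 3 | t ≠ 1 ∧ Circle.exp (p w 1) ≠ Circle.exp (p w t)}), {c | Circle.exp (c w 1) ≠ Circle.exp (c w t)} := by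
        ext c; simp only [mem_setOf_eq, mem_iInter, mem_compl_iff, Finset.mem_coe, and_imp]
      rw [h]
      exact (Set.toFinite _).isOpen_biInter fun w _ => (Set.toFinite _).isOpen_biInter fun t _ =>
        isOpen_ne_fun (continuous_circleExp_coord w 1) (continuous_circleExp_coord w t)
  have hpO : p ∈ O := by rw [hOdef]; exact ⟨⟨hp, fun w _ h => h⟩, fun w _ t _ h => h⟩
  obtain ⟨U, hUdef⟩ : ∃ U : Set ({w : InfinitePlace L // IsComplex w} → Fin 3 → ℝ), U = ball p (Real.pi / 2) ∩ O := ⟨_, rfl⟩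
  have hU : IsOpen U := by rw [hUdef]; exact isOpen_ball.inter hO
  have hpU : p ∈ U := by rw [hUdef]; exact ⟨mem_ball_self hπ, hpO⟩
  -- accessors for the points of `U`
  have hUball : ∀ c ∈ U, c ∈ ball p (Real.pi / 2) := fun c hc => by rw [hUdef] at hc; exact hc.1
  have hUI : ∀ c ∈ U, c ∈ InRegS S := fun c hc => by rw [hUdef, hOdef] at hc; exact hc.2.1.1
  have hUS : ∀ c ∈ U, ∀ w ∈ S, p w 0 ≠ 0 → c w 0 ≠ 0 := fun c hc => by rw [hUdef, hOdef] at hc; exact hc.2.1.2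
  have hUG : ∀ c ∈ U, ∀ w, w ∉ S → ∀ t : Fin 3, t ≠ 1 → Circle.exp (p w 1) ≠ Circle.exp (p w t) → Circle.exp (c w 1) ≠ Circle.exp (c w t) :=
    fun c hc => by rw [hUdef, hOdef] at hc; exact hc.2.2
  -- same `2π`-branch inside `U`: a `G`-wall point of `U` at a wall of `T` lies ON that wall
  have hbranch : ∀ c ∈ U, ∀ w, w ∉ S → ∀ t : Fin 3, t ≠ 1 → Circle.exp (p w 1) = Circle.exp (p w t) →
      Circle.exp (c w 1) = Circle.exp (c w t) → c w 1 - c w t = p w 1 - p w t := by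
    intro c hc w _ t _ hpw hcw
    exact sub_eq_sub_of_circleExp_eq hpw hcw (abs_sub_lt_of_mem_ball hπ (hUball c hc) w 1) (abs_sub_lt_of_mem_ball hπ (hUball c hc) w t)
  -- (K1) inside `U`, `T`-regular ⟺ `G`-regular
  have hK1 : ∀ c ∈ U, (c ∈ RegG S ↔ ∀ q ∈ T, ℓ q c ≠ a q) := by
    intro c hc
    constructor
    · intro hcR q hq habs
      rw [hℓ] at habs
      rcases (hT q).1 hq with ⟨h1, h2, _⟩ | ⟨h1, h2, h3⟩
      · simp only [h2, if_true, hadef] at habs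
        exact ((mem_regG_iff S c).1 hcR).2 q.1 h1 habs
      · simp only [h2, if_false, hadef] at habs
        have hinj := ((mem_regG_iff S c).1 hcR).1 q.1 h1
        have heq : Circle.exp (c q.1 1) = Circle.exp (c q.1 q.2) := by
          rw [Circle.exp_eq_exp]
          obtain ⟨m, hm⟩ := Circle.exp_eq_exp.1 h3
          exact ⟨m, by linarith⟩
        exact h2 (hinj heq.symm)
    · intro hreg
      rw [mem_regG_iff]
      refine ⟨fun w hw => ?_, fun w hw => ?_⟩
      · have h02 : Circle.exp (c w 0) ≠ Circle.exp (c w 2) := hUI c hc w hw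
        have hne : ∀ t : Fin 3, t ≠ 1 → Circle.exp (c w 1) ≠ Circle.exp (c w t) := by
          intro t ht hct
          by_cases hpt : Circle.exp (p w 1) = Circle.exp (p w t)
          · have hq : (w, t) ∈ T := (hT (w, t)).2 (Or.inr ⟨hw, ht, hpt⟩)
            have h1 := hreg (w, t) hq
            rw [hℓ] at h1
            simp only [ht, if_false, hadef] at h1
            exact h1 (hbranch c hc w hw t ht hpt hct)
          · exact hUG c hc w hw t ht hpt hct
        exact injective_circleExp_of_ne (hne 0 (by decide)).symm h02 (hne 2 (by decide))
      · by_cases hp0 : p w 0 = 0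
        · have hq : (w, (1 : Fin 3)) ∈ T := (hT (w, 1)).2 (Or.inl ⟨hw, rfl, hp0⟩)
          have h1 := hreg (w, 1) hq
          rw [hℓ] at h1
          simpa [hadef] using h1
        · exact hUS c hc w hw hp0
  have hUreg : U ∩ {c | ∀ q ∈ T, ℓ q c ≠ a q} = U ∩ RegG S := by
    ext c; exact ⟨fun h => ⟨h.1, (hK1 c h.1).2 h.2⟩, fun h => ⟨h.1, (hK1 c h.1).1 h.2⟩⟩
  -- (K3) the glue of the arrangement theorem IS `transfFam … S` on `U`
  have hglue : ∀ y ∈ U, extendFrom (U ∩ {c | ∀ q ∈ T, ℓ q c ≠ a q}) f y = transfFam L α μ F S y := by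
    intro y hy
    rw [hUreg, hext y (hUI y hy), extendFrom_congr_of_nhdsWithin_eq (nhdsWithin_inter_eq_of_isOpen hU hy)]
  -- apply the arrangement gluing
  have hmain := contDiffOn_extendFrom_of_arrangement ℓ a T (fun q hq => ?_) hU (fun q hq x _ _ => ?_) (f := f) (by rw [hUreg]; exact hfreg.mono inter_subset_right)
    (fun x hx _ n => ?_) (fun q hq x hx hxq hoth => ?_)
  · exact ⟨U, hU, hpU, (hmain.congr fun y hy => (hglue y hy).symm).mono inter_subset_right⟩
  · -- `ℓ q ≠ 0`
    intro h0
    rcases (hT q).1 hq with ⟨_, h2, _⟩ | ⟨_, h2, _⟩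
    · have h1 := hℓ q (Pi.single q.1 (Pi.single 0 1))
      rw [h0, h2] at h1
      simp at h1
    · have h1 := hℓ q (Pi.single q.1 (Pi.single 1 1))
      rw [h0] at h1
      rw [Pi.single_eq_same, Pi.single_eq_same, Pi.single_eq_of_ne h2] at h1
      simp only [zero_apply, h2, if_false] at h1
      norm_num at h1
  · -- transversality: the sum of the coordinate vectors of the other walls
    refine ⟨∑ j ∈ T.erase q, if j.2 = 1 then Pi.single j.1 (Pi.single 0 (1 : ℝ)) else Pi.single j.1 (Pi.single 1 (1 : ℝ)), ?_, fun j hj hne _ => ?_⟩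
    · rw [map_sum]
      refine Finset.sum_eq_zero fun j hj => ?_
      have hjq : j.1 ≠ q.1 := fun h => (Finset.mem_erase.1 hj).1 (hplace j (Finset.mem_erase.1 hj).2 q hq h)
      rw [hℓ]
      by_cases h2 : j.2 = 1 <;> by_cases hq2 : q.2 = 1 <;> simp [h2, hq2, Pi.single_eq_of_ne' hjq]
    · rw [map_sum, Finset.sum_eq_single_of_mem j (Finset.mem_erase.2 ⟨hne, hj⟩) fun j' hj' hj'j => ?_]
      · rw [hℓ]
        by_cases h2 : j.2 = 1
        · simp [h2]
        · simp only [h2, if_false, Pi.single_eq_same]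
          rw [Pi.single_eq_of_ne h2]
          norm_num
      · have hj'1 : j'.1 ≠ j.1 := fun h => hj'j (hplace j' (Finset.mem_erase.1 hj').2 j hj h)
        rw [hℓ]
        by_cases h2 : j'.2 = 1 <;> by_cases hj2 : j.2 = 1 <;> simp [h2, hj2, Pi.single_eq_of_ne' hj'1]
  · -- jet bounds near a wall point, from `ArchTransfFamilyJetBounds`
    obtain ⟨C, hC⟩ := bddAbove_norm_iteratedFDeriv_transfFamReg L α μ hμω hS hI1 hI1b n (isCompact_closedBall x 1)
    rw [hfdef]
    refine ⟨C, ?_⟩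
    filter_upwards [(isOpen_ball.inter hU).mem_nhds (⟨mem_ball_self zero_lt_one, hx⟩ : x ∈ ball x 1 ∩ U)] with y hy hreg
    exact mem_upperBounds.1 hC _ ⟨y, ⟨ball_subset_closedBall hy.1, (hK1 y hy.2).2 hreg⟩, rfl⟩
  · -- a SIMPLE wall point: tame (real wall ∕ definite place) or `hwall` (indefinite place)
    have hxU : x ∈ U := hx
    -- regularity of `x` at every compact place other than `q.1`, and off the real walls other than `q.1`
    have hoff : ∀ w, w ∉ S → w ≠ q.1 → Function.Injective fun l : Fin 3 => Circle.exp (x w l) := by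
      intro w hw hwq
      have h02 : Circle.exp (x w 0) ≠ Circle.exp (x w 2) := hUI x hxU w hw
      have hne : ∀ t : Fin 3, t ≠ 1 → Circle.exp (x w 1) ≠ Circle.exp (x w t) := by
        intro t ht hct
        by_cases hpt : Circle.exp (p w 1) = Circle.exp (p w t)
        · have hq' : (w, t) ∈ T := (hT (w, t)).2 (Or.inr ⟨hw, ht, hpt⟩)
          have h1 := hoth (w, t) hq' (fun h => hwq (congrArg Prod.fst h))
          rw [hℓ] at h1
          simp only [ht, if_false, hadef] at h1
          exact h1 (hbranch x hxU w hw t ht hpt hct)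
        · exact hUG x hxU w hw t ht hpt hct
      exact injective_circleExp_of_ne (hne 0 (by decide)).symm h02 (hne 2 (by decide))
    have hxS : ∀ w ∈ S, w ≠ q.1 → x w 0 ≠ 0 := by
      intro w hw hwq
      by_cases hp0 : p w 0 = 0
      · have hq' : (w, (1 : Fin 3)) ∈ T := (hT (w, 1)).2 (Or.inl ⟨hw, rfl, hp0⟩)
        have h1 := hoth (w, 1) hq' (fun h => hwq (congrArg Prod.fst h))
        rw [hℓ] at h1
        simpa [hadef] using h1
      · exact hUS x hxU w hw hp0
    -- the local smoothness of `transfFam … S` at `x`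
    have hloc : ∃ V ∈ 𝓝 x, ContDiffOn ℝ ∞ (transfFam L α μ F S) V := by
      rcases (hT q).1 hq with ⟨h1, h2, _⟩ | ⟨h1, h2, h3⟩
      · -- a real wall: `x` is `G`-regular at every compact place ⇒ tame
        obtain ⟨V, hV, _, hVs⟩ := exists_nhds_contDiffOn_transfFam_of_injective L α μ hμω hS hI1 (hUI x hxU)
          fun w hw _ => hoff w hw (by rintro rfl; exact hw h1)
        exact ⟨V, hV, hVs⟩
      · by_cases hind : IsIndefiniteAt (slotSign L α) q.1
        · -- an indefinite place: the input `hwall`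
          have hxq : Circle.exp (x q.1 1) = Circle.exp (x q.1 q.2) := by
            have e1 := hxq
            rw [hℓ] at e1
            simp only [h2, if_false, hadef] at e1
            rw [Circle.exp_eq_exp]
            obtain ⟨m, hm⟩ := Circle.exp_eq_exp.1 h3
            exact ⟨m, by linarith⟩
          exact hwall q.1 h1 hind q.2 h2 x (hUI x hxU) hxq hoff fun w hw => hxS w hw fun h => h1 (h ▸ hw)
        · -- a definite place: tame
          obtain ⟨V, hV, _, hVs⟩ := exists_nhds_contDiffOn_transfFam_of_injective L α μ hμω hS hI1 (hUI x hxU)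
            fun w hw hw' => hoff w hw fun h => hind (h ▸ hw')
          exact ⟨V, hV, hVs⟩
    obtain ⟨V, hV, hVs⟩ := hloc
    refine ⟨V ∩ U, inter_mem hV (hU.mem_nhds hxU), (hVs.mono inter_subset_left).congr fun y hy => hglue y hy.2⟩

end Assembly

/-! ## §4 (c2): the (I₁) bound on `K ∩ InRegS S` from the bound on `K′ ∩ RegG S` (density of `RegG S`, continuity of the jets) -/

section Bounds

variable (L : Type) [Field L] [NumberField L] [IsCMField L] (α : Fin 3 → L) (μ : HeckeCharacter L)

/-- **(c2) Bouaziz's (I₁) for `transfFam … S` on `K ∩ InRegS S`**: once `transfFam … S` is `C^∞` on `InRegS S`, its jets are bounded on `K ∩ InRegS S` for every compact `K` — they are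
limits of jets of `transfFamReg` from the dense `G`-regular set, bounded on the compact thickening `cthickening 1 K` (`ArchTransfFamilyJetBounds`); in particular NO blow-up at the
removed `H`-imaginary walls `e^{ic_{w0}} = e^{ic_{w2}}`. [cite: Bouaziz1994IntegralesOrbitales, §3.2 (I₁) p. 579] [cite: Shelstad1979, §4 (I) p. 23] -/
theorem bddAbove_norm_iteratedFDeriv_transfFam_of_contDiffOn
    (hμω : ∀ x : ideleGroup ↥(maximalRealSubfield L), μ (AdeleRing.ideleBaseChange (↥(maximalRealSubfield L)) L x) = quadraticHeckeCharCM L x)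
    {S : Finset {w : InfinitePlace L // IsComplex w}} (hS : ∀ w ∈ S, w ∈ splitChartPlaces L α)
    {F : Finset {w : InfinitePlace L // IsComplex w} → ({w : InfinitePlace L // IsComplex w} → Fin 3 → ℝ) → ℂ}
    (hI1 : ContDiffOn ℝ ∞ (F S) (InRegG (slotSign L α) S))
    (hI1b : ∀ (n : ℕ) (K : Set ({w : InfinitePlace L // IsComplex w} → Fin 3 → ℝ)), IsCompact K →
      BddAbove ((fun c => ‖iteratedFDeriv ℝ n (F S) c‖) '' (K ∩ InRegG (slotSign L α) S)))
    (hc1 : ContDiffOn ℝ ∞ (transfFam L α μ F S) (InRegS S))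
    (n : ℕ) {K : Set ({w : InfinitePlace L // IsComplex w} → Fin 3 → ℝ)} (hK : IsCompact K) :
    BddAbove ((fun c => ‖iteratedFDeriv ℝ n (transfFam L α μ F S) c‖) '' (K ∩ InRegS S)) := by
  obtain ⟨C, hC⟩ := bddAbove_norm_iteratedFDeriv_transfFamReg L α μ hμω hS hI1 hI1b n (hK.cthickening (r := 1))
  refine ⟨C, ?_⟩
  rintro _ ⟨y, hy, rfl⟩
  dsimp only
  -- jets of `transfFam` are continuous on the open `InRegS S` and agree with those of `transfFamReg` on the open `RegG S`
  have hcont : ContinuousOn (iteratedFDeriv ℝ n (transfFam L α μ F S)) (InRegS S) := continuousOn_iteratedFDeriv_of_isOpen (isOpen_inRegS S) hc1 n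
  have heq : ∀ z ∈ RegG S, iteratedFDeriv ℝ n (transfFam L α μ F S) z = iteratedFDeriv ℝ n (transfFamReg L α μ F S) z :=
    fun z hz => iteratedFDeriv_eq_of_eqOn_isOpen (isOpen_regG S) (transfFam_eqOn_regG L α μ F S) hz n
  -- `y` is a limit of `G`-regular points of the unit ball around it
  have hycl : y ∈ closure (ball y 1 ∩ RegG S) := (dense_regG S).open_subset_closure_inter isOpen_ball (mem_ball_self zero_lt_one)
  haveI : (𝓝[ball y 1 ∩ RegG S] y).NeBot := mem_closure_iff_nhdsWithin_neBot.1 hycl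
  have ht : Tendsto (fun z => ‖iteratedFDeriv ℝ n (transfFam L α μ F S) z‖) (𝓝[ball y 1 ∩ RegG S] y) (𝓝 ‖iteratedFDeriv ℝ n (transfFam L α μ F S) y‖) :=
    (continuous_norm.continuousAt.comp_continuousWithinAt (hcont y hy.2)).mono_left
      (nhdsWithin_mono y fun z hz => regS_subset_inRegS S (regG_subset_regS S hz.2))
  refine le_of_tendsto ht (eventually_of_mem self_mem_nhdsWithin fun z hz => ?_)
  rw [heq z hz.2]
  refine mem_upperBounds.1 hC _ ⟨z, ⟨?_, hz.2⟩, rfl⟩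
  exact mem_cthickening_of_dist_le z y 1 K hy.1 (le_of_lt (mem_ball.1 hz.1))

end Bounds

/-! ## §5 The organ-grade head (SB-TRANSF) modulo `hwall`, and (M2) as its corollary -/

section Head

variable (L : Type) [Field L] [NumberField L] [IsCMField L] (α : Fin 3 → L) (μ : HeckeCharacter L)

/-- **(SB-TRANSF) modulo the κ-pair gluing: `ArchBzSmoothBounded (transfFam L α μ F)`** — Bouaziz's (I₁)+(I₂) for the `Δ″`-transfer of a family `F` satisfying HC's (I₁) on every
chart (`C^∞` on ★ `InRegG` with bounded jets), under the `μ`-guard, GIVEN `hwall` (F0P3a-p09 (g5)'s FILE B head at the indefinite compact places, for every ADMISSIBLE chart).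
Inadmissible charts carry the zero family (★ p850030). [cite: Bouaziz1994IntegralesOrbitales, §3.2 (I₁)–(I₂) p. 579; §6.2 p. 591; Rem. 2 p. 594] [cite: Shelstad1979, Thm. 4.7 (p. 31)] -/
theorem archBzSmoothBounded_transfFam_of_wall
    (hμω : ∀ x : ideleGroup ↥(maximalRealSubfield L), μ (AdeleRing.ideleBaseChange (↥(maximalRealSubfield L)) L x) = quadraticHeckeCharCM L x)
    {F : Finset {w : InfinitePlace L // IsComplex w} → ({w : InfinitePlace L // IsComplex w} → Fin 3 → ℝ) → ℂ}
    (hI1 : ∀ S, ContDiffOn ℝ ∞ (F S) (InRegG (slotSign L α) S))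
    (hI1b : ∀ (S : Finset {w : InfinitePlace L // IsComplex w}) (n : ℕ) (K : Set ({w : InfinitePlace L // IsComplex w} → Fin 3 → ℝ)), IsCompact K →
      BddAbove ((fun c => ‖iteratedFDeriv ℝ n (F S) c‖) '' (K ∩ InRegG (slotSign L α) S)))
    (hwall : ∀ S : Finset {w : InfinitePlace L // IsComplex w}, (∀ w ∈ S, w ∈ splitChartPlaces L α) →
      ∀ w : {w : InfinitePlace L // IsComplex w}, w ∉ S → IsIndefiniteAt (slotSign L α) w → ∀ t : Fin 3, t ≠ 1 →
      ∀ q : {w : InfinitePlace L // IsComplex w} → Fin 3 → ℝ, q ∈ InRegS S → Circle.exp (q w 1) = Circle.exp (q w t) →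
        (∀ w', w' ∉ S → w' ≠ w → Function.Injective fun l : Fin 3 => Circle.exp (q w' l)) → (∀ w' ∈ S, q w' 0 ≠ 0) →
        ∃ V ∈ 𝓝 q, ContDiffOn ℝ ∞ (transfFam L α μ F S) V) :
    ArchBzSmoothBounded (transfFam L α μ F) := by
  intro S
  by_cases hS : ∀ w, w ∈ S → w ∈ splitChartPlaces L α
  · have hc1 := contDiffOn_transfFam_inRegS_of_wall L α μ hμω hS (hI1 S) (hI1b S) (hwall S hS)
    exact ⟨hc1, fun n K hK => bddAbove_norm_iteratedFDeriv_transfFam_of_contDiffOn L α μ hμω hS (hI1 S) (hI1b S) hc1 n hK⟩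
  · rw [transfFam_eq_zero_of_not_admissible L α μ F hS]
    refine ⟨contDiffOn_const, fun n K _ => ⟨0, ?_⟩⟩
    rintro _ ⟨y, _, rfl⟩
    simp only [iteratedFDeriv_fun_zero, Pi.zero_apply, norm_zero, le_refl]

/-- **(SB-TRANSF) for `F` in the HC space ★ `ArchHCSpaceG (slotSign L α) jc′ F`**, modulo `hwall`. [cite: Bouaziz1994IntegralesOrbitales, §3.2 (I₁)–(I₂) p. 579; Rem. 2 p. 594]
[cite: Shelstad1979, Thm. 4.7 (p. 31)] -/
theorem archBzSmoothBounded_transfFam_of_hc_of_wall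
    (hμω : ∀ x : ideleGroup ↥(maximalRealSubfield L), μ (AdeleRing.ideleBaseChange (↥(maximalRealSubfield L)) L x) = quadraticHeckeCharCM L x)
    {jc' : Finset {w : InfinitePlace L // IsComplex w} → {w : InfinitePlace L // IsComplex w} → Fin 3 → Fin 3 → ℂ}
    {F : Finset {w : InfinitePlace L // IsComplex w} → ({w : InfinitePlace L // IsComplex w} → Fin 3 → ℝ) → ℂ} (hF : ArchHCSpaceG (slotSign L α) jc' F)
    (hwall : ∀ S : Finset {w : InfinitePlace L // IsComplex w}, (∀ w ∈ S, w ∈ splitChartPlaces L α) →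
      ∀ w : {w : InfinitePlace L // IsComplex w}, w ∉ S → IsIndefiniteAt (slotSign L α) w → ∀ t : Fin 3, t ≠ 1 →
      ∀ q : {w : InfinitePlace L // IsComplex w} → Fin 3 → ℝ, q ∈ InRegS S → Circle.exp (q w 1) = Circle.exp (q w t) →
        (∀ w', w' ∉ S → w' ≠ w → Function.Injective fun l : Fin 3 => Circle.exp (q w' l)) → (∀ w' ∈ S, q w' 0 ≠ 0) →
        ∃ V ∈ 𝓝 q, ContDiffOn ℝ ∞ (transfFam L α μ F S) V) :
    ArchBzSmoothBounded (transfFam L α μ F) :=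
  archBzSmoothBounded_transfFam_of_wall L α μ hμω (fun S => (hF.2.2.1 S).1) (fun S n K hK => (hF.2.2.1 S).2.1 n K hK) hwall

/-- **(M2) `hcont` of ★ p850030 ∕ the L2 assembler** — continuity of every `transfFam … S` on `InRegS S` — as the corollary of (SB-TRANSF) modulo `hwall` (★ `ArchBzSmoothBounded.continuousOn`
would do the same through p850089; spelled out here in p850030's binder shape). [cite: Bouaziz1994IntegralesOrbitales, §3.2 (I₁) p. 579] -/
theorem continuousOn_transfFam_inRegS_of_hc_of_wall
    (hμω : ∀ x : ideleGroup ↥(maximalRealSubfield L), μ (AdeleRing.ideleBaseChange (↥(maximalRealSubfield L)) L x) = quadraticHeckeCharCM L x)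
    {jc' : Finset {w : InfinitePlace L // IsComplex w} → {w : InfinitePlace L // IsComplex w} → Fin 3 → Fin 3 → ℂ}
    {F : Finset {w : InfinitePlace L // IsComplex w} → ({w : InfinitePlace L // IsComplex w} → Fin 3 → ℝ) → ℂ} (hF : ArchHCSpaceG (slotSign L α) jc' F)
    (hwall : ∀ S : Finset {w : InfinitePlace L // IsComplex w}, (∀ w ∈ S, w ∈ splitChartPlaces L α) →
      ∀ w : {w : InfinitePlace L // IsComplex w}, w ∉ S → IsIndefiniteAt (slotSign L α) w → ∀ t : Fin 3, t ≠ 1 →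
      ∀ q : {w : InfinitePlace L // IsComplex w} → Fin 3 → ℝ, q ∈ InRegS S → Circle.exp (q w 1) = Circle.exp (q w t) →
        (∀ w', w' ∉ S → w' ≠ w → Function.Injective fun l : Fin 3 => Circle.exp (q w' l)) → (∀ w' ∈ S, q w' 0 ≠ 0) →
        ∃ V ∈ 𝓝 q, ContDiffOn ℝ ∞ (transfFam L α μ F S) V) :
    ∀ S : Finset {w : InfinitePlace L // IsComplex w}, (∀ w, w ∈ S → w ∈ splitChartPlaces L α) → ContinuousOn (transfFam L α μ F S) (InRegS S) :=
  fun S _ => (archBzSmoothBounded_transfFam_of_hc_of_wall L α μ hμω hF hwall S).1.continuousOn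

end Head

end Literature.NumberTheory.Rogawski1990

end
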